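import Summits.NavierStokesRegularity.NavierStokesRegularity.Theorems.EfficiencyFloorNearSaturationNearMaximiserSeqCoreSplitting
import HarnessLib

/-!
# Route `EfficiencyFloor`, ladder of `ProductionEfficiencyDecay` (stmt-22866): the Euler–Lagrange identity of the
# Lu–Doering extremisers (cruxes `MaximiserSetRigidity` stmt-25512 / `NearSaturationNearMaximiser` stmt-25482)

Def-free helper file. The rigidity / regularity analysis of the maximisers of the Lu–Doering efficiency
`S(v)/(Z(v)^{3/4} Pal(v)^{3/4})` (`S = ∫⟪curl v, Dv curl v⟫`, `Z = ∫‖curl v‖²`, `Pal = ∫|D curl v|²_F`) over the admissible class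
(smooth, divergence free, `D⁰, D¹, D² ∈ L²`) starts from the FIRST VARIATION. This file proves it in the tree's smooth framework:

* `enstrophy_variation`, `palinstrophy_variation`, `stretching_variation` — along the admissible segment `s ↦ m + s h` the three
  functionals are the explicit polynomials `Z(m) + 2sB + s²Z(h)`, `Pal(m) + 2sP₁ + s²Pal(h)`,
  `S(m) + sS₁ + s²S₂ + s³S(h)` (`B = ∫⟪curl m, curl h⟫`, `P₁ = ∫Σᵢ⟪D curl m eᵢ, D curl h eᵢ⟫`, `S₁, S₂` the mixed trilinear terms);
* `eulerLagrange_of_maximiser` — **Euler–Lagrange identity**: if `c` is an admissible Lu–Doering constant and the admissible `m`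
  with `Z(m), Pal(m) > 0` SATURATES it, `S(m) = c Z(m)^{3/4} Pal(m)^{3/4}`, then for every admissible direction `h`
  `S₁(m; h) = (3/2) · c Z(m)^{3/4} Pal(m)^{3/4} · (B/Z(m) + P₁/Pal(m))`, i.e. the weak form of
  `δS(m) = (3/2) S(m) (−Δm/Z(m) + Δ²m/Pal(m))` (tested on admissible fields): `s = 0` is a maximum of the `C¹` function
  `s ↦ S(m+sh) − c (Z(m+sh) Pal(m+sh))^{3/4}`;
* `eulerLagrange_of_normalisedMaximiser` — the normal form `Z = Pal = 1`: `S₁(m; h) = (3c/2)(B + P₁)`.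

HONEST FRAMING: a first-order identity about maximisers IF they exist; attainment, `MaximiserSetRigidity` (stmt-25512),
`NearSaturationNearMaximiser` (stmt-25482), `ProductionEfficiencyDecay` (stmt-22866) and Navier–Stokes regularity stay OPEN; no
summit statement is proved. [cite: LuDoering2008, §3 (Euler–Lagrange equations of the enstrophy-production problem)]
-/

-- the problem directory repeats the summit name (`NavierStokesRegularity/NavierStokesRegularity`)
set_option linter.dupNamespace false

noncomputable section

namespace Summit.NavierStokesRegularity.NavierStokesRegularity.Theorems

namespace NearSaturationNearMaximiser

namespace SeqCore

open Set MeasureTheory Filter Topology Function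
open scoped InnerProductSpace ENNReal
open Literature.Analysis.FluidPDE

/-! ## §1 The admissible segment `s ↦ m + s h` -/

/-- `m + s h` written as `m − (−s)•h` is admissible for admissible `m, h`. [folklore] -/
theorem admissible_segment {m h : EuclideanSpace ℝ (Fin 3) → EuclideanSpace ℝ (Fin 3)}
    (hm : ContDiff ℝ (⊤ : ℕ∞) m ∧ VectorCalculus.IsDivFree m ∧ (∫⁻ x, ‖iteratedFDeriv ℝ 0 m x‖ₑ ^ 2 < ⊤) ∧
      (∫⁻ x, ‖iteratedFDeriv ℝ 1 m x‖ₑ ^ 2 < ⊤) ∧ (∫⁻ x, ‖iteratedFDeriv ℝ 2 m x‖ₑ ^ 2 < ⊤))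
    (hh : ContDiff ℝ (⊤ : ℕ∞) h ∧ VectorCalculus.IsDivFree h ∧ (∫⁻ x, ‖iteratedFDeriv ℝ 0 h x‖ₑ ^ 2 < ⊤) ∧
      (∫⁻ x, ‖iteratedFDeriv ℝ 1 h x‖ₑ ^ 2 < ⊤) ∧ (∫⁻ x, ‖iteratedFDeriv ℝ 2 h x‖ₑ ^ 2 < ⊤)) (s : ℝ) :
    ContDiff ℝ (⊤ : ℕ∞) (m - fun y => (-s) • h y) ∧ VectorCalculus.IsDivFree (m - fun y => (-s) • h y) ∧
      (∫⁻ x, ‖iteratedFDeriv ℝ 0 (m - fun y => (-s) • h y) x‖ₑ ^ 2 < ⊤) ∧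
      (∫⁻ x, ‖iteratedFDeriv ℝ 1 (m - fun y => (-s) • h y) x‖ₑ ^ 2 < ⊤) ∧
      (∫⁻ x, ‖iteratedFDeriv ℝ 2 (m - fun y => (-s) • h y) x‖ₑ ^ 2 < ⊤) :=
  admissible_sub hm (admissible_const_smul hh (-s))

/-- Pointwise: `curl (m − (−s)h) = curl m + s curl h` and `D(m − (−s)h) = Dm + s Dh`; `(m − (−s)h) − m = s h`. [folklore] -/
theorem segment_pointwise {m h : EuclideanSpace ℝ (Fin 3) → EuclideanSpace ℝ (Fin 3)} (hm : ContDiff ℝ (⊤ : ℕ∞) m)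
    (hh : ContDiff ℝ (⊤ : ℕ∞) h) (s : ℝ) :
    (∀ x, curl (m - fun y => (-s) • h y) x = curl m x + s • curl h x) ∧
      (∀ x, fderiv ℝ (m - fun y => (-s) • h y) x = fderiv ℝ m x + s • fderiv ℝ h x) ∧
      ((m - fun y => (-s) • h y) - m = fun y => s • h y) ∧
      (∀ x, curl (fun y => s • h y) x = s • curl h x) ∧ (∀ x, fderiv ℝ (fun y => s • h y) x = s • fderiv ℝ h x) := by
  have hmd : Differentiable ℝ m := hm.differentiable (by simp)
  have hhd : Differentiable ℝ h := hh.differentiable (by simp)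
  have hgd : Differentiable ℝ (fun y => (-s) • h y) := hhd.const_smul (-s)
  have hcg : curl (fun y => (-s) • h y) = fun x => (-s) • curl h x := curl_const_smul_eq hhd (-s)
  refine ⟨fun x => ?_, fun x => ?_, ?_, fun x => ?_, fun x => ?_⟩
  · rw [congrFun (curl_sub_eq hmd hgd) x, hcg]
    simp only [neg_smul, sub_neg_eq_add]
  · have h1 : fderiv ℝ (m - fun y => (-s) • h y) x = fderiv ℝ m x - fderiv ℝ (fun y => (-s) • h y) x :=
      fderiv_sub (hmd x) (hgd x)
    rw [h1, fderiv_fun_const_smul (hhd x) (-s), neg_smul, sub_neg_eq_add]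
  · funext y
    simp only [Pi.sub_apply, neg_smul, sub_neg_eq_add, add_sub_cancel_left]
  · rw [congrFun (curl_const_smul_eq hhd s) x]
  · exact fderiv_fun_const_smul (hhd x) s

/-- Frobenius square of `A + sB`: `|A + sB|²_F = |A|²_F + 2sΣᵢ⟪Aeᵢ, Beᵢ⟫ + s²|B|²_F` (standard basis of `ℝ³`). [folklore] -/
theorem frobeniusNormSq_add_smul (A B : EuclideanSpace ℝ (Fin 3) →L[ℝ] EuclideanSpace ℝ (Fin 3)) (s : ℝ) :
    frobeniusNormSq (A + s • B) = frobeniusNormSq A +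
      2 * s * ∑ i, ⟪A (EuclideanSpace.basisFun (Fin 3) ℝ i), B (EuclideanSpace.basisFun (Fin 3) ℝ i)⟫_ℝ +
      s ^ 2 * frobeniusNormSq B := by
  rw [frobeniusNormSq_eq_sum (EuclideanSpace.basisFun (Fin 3) ℝ), frobeniusNormSq_eq_sum (EuclideanSpace.basisFun (Fin 3) ℝ),
    frobeniusNormSq_eq_sum (EuclideanSpace.basisFun (Fin 3) ℝ), Finset.mul_sum, Finset.mul_sum, ← Finset.sum_add_distrib,
    ← Finset.sum_add_distrib]
  refine Finset.sum_congr rfl fun i _ => ?_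
  simp only [add_apply, FunLike.coe_smul, Pi.smul_apply]
  rw [norm_add_sq_real, real_inner_smul_right, norm_smul, mul_pow, Real.norm_eq_abs, sq_abs]
  ring

/-! ## §2 The three functionals along the segment are polynomials -/

/-- **Enstrophy along the segment**: `Z(m + sh) = Z(m) + 2s∫⟪curl m, curl h⟫ + s²Z(h)`. [folklore] -/
theorem enstrophy_variation {m h : EuclideanSpace ℝ (Fin 3) → EuclideanSpace ℝ (Fin 3)}
    (hm : ContDiff ℝ (⊤ : ℕ∞) m) (hm1 : ∫⁻ x, ‖iteratedFDeriv ℝ 1 m x‖ₑ ^ 2 < ⊤)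
    (hh : ContDiff ℝ (⊤ : ℕ∞) h) (hh1 : ∫⁻ x, ‖iteratedFDeriv ℝ 1 h x‖ₑ ^ 2 < ⊤) (s : ℝ) :
    (∫ x, ‖curl (m - fun y => (-s) • h y) x‖ ^ 2) =
      (∫ x, ‖curl m x‖ ^ 2) + 2 * s * (∫ x, ⟪curl m x, curl h x⟫_ℝ) + s ^ 2 * ∫ x, ‖curl h x‖ ^ 2 := by
  obtain ⟨Imh, -⟩ := enstrophy_sub_expand hm hm1 hh hh1
  have Im := (integrable_norm_curl_sq (hm.of_le (by norm_cast)) hm1).1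
  have Ih := (integrable_norm_curl_sq (hh.of_le (by norm_cast)) hh1).1
  obtain ⟨hc, -, -, -, -⟩ := segment_pointwise hm hh s
  have hpt : ∀ x, ‖curl (m - fun y => (-s) • h y) x‖ ^ 2 =
      ‖curl m x‖ ^ 2 + 2 * s * ⟪curl m x, curl h x⟫_ℝ + s ^ 2 * ‖curl h x‖ ^ 2 := fun x => by
    rw [hc x, norm_add_sq_real, real_inner_smul_right, norm_smul, mul_pow, Real.norm_eq_abs, sq_abs]
    ring
  simp_rw [hpt]
  rw [integral_add (f := fun x => ‖curl m x‖ ^ 2 + 2 * s * ⟪curl m x, curl h x⟫_ℝ) (g := fun x => s ^ 2 * ‖curl h x‖ ^ 2)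
      (Im.add (Imh.const_mul _)) (Ih.const_mul _),
    integral_add (f := fun x => ‖curl m x‖ ^ 2) (g := fun x => 2 * s * ⟪curl m x, curl h x⟫_ℝ) Im (Imh.const_mul _),
    integral_const_mul, integral_const_mul]

/-- **Palinstrophy along the segment**: `Pal(m + sh) = Pal(m) + 2s∫Σᵢ⟪D curl m eᵢ, D curl h eᵢ⟫ + s²Pal(h)`. [folklore] -/
theorem palinstrophy_variation {m h : EuclideanSpace ℝ (Fin 3) → EuclideanSpace ℝ (Fin 3)}
    (hm : ContDiff ℝ (⊤ : ℕ∞) m) (hm2 : ∫⁻ x, ‖iteratedFDeriv ℝ 2 m x‖ₑ ^ 2 < ⊤)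
    (hh : ContDiff ℝ (⊤ : ℕ∞) h) (hh2 : ∫⁻ x, ‖iteratedFDeriv ℝ 2 h x‖ₑ ^ 2 < ⊤) (s : ℝ) :
    (∫ x, frobeniusNormSq (fderiv ℝ (curl (m - fun y => (-s) • h y)) x)) =
      (∫ x, frobeniusNormSq (fderiv ℝ (curl m) x)) +
        2 * s * (∫ x, ∑ i, ⟪fderiv ℝ (curl m) x (EuclideanSpace.basisFun (Fin 3) ℝ i),
          fderiv ℝ (curl h) x (EuclideanSpace.basisFun (Fin 3) ℝ i)⟫_ℝ) +
        s ^ 2 * ∫ x, frobeniusNormSq (fderiv ℝ (curl h) x) := by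
  obtain ⟨Imh, -⟩ := palinstrophy_sub_expand hm hm2 hh hh2
  have Im := (integrable_frobeniusNormSq_fderiv_curl (hm.of_le (by norm_cast) : ContDiff ℝ 3 m) hm2).1
  have Ih := (integrable_frobeniusNormSq_fderiv_curl (hh.of_le (by norm_cast) : ContDiff ℝ 3 h) hh2).1
  obtain ⟨hc, -, -, -, -⟩ := segment_pointwise hm hh s
  have hcm : ContDiff ℝ 1 (curl m) := contDiff_curl (n := 1) (hm.of_le (by norm_cast))
  have hch : ContDiff ℝ 1 (curl h) := contDiff_curl (n := 1) (hh.of_le (by norm_cast))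
  have hcurl : curl (m - fun y => (-s) • h y) = curl m + s • curl h := funext fun x => by
    rw [hc x]; rfl
  have hfd : ∀ x, fderiv ℝ (curl (m - fun y => (-s) • h y)) x = fderiv ℝ (curl m) x + s • fderiv ℝ (curl h) x := fun x => by
    rw [hcurl, fderiv_add ((hcm.differentiable one_ne_zero) x) (((hch.differentiable one_ne_zero) x).const_smul s),
      fderiv_const_smul ((hch.differentiable one_ne_zero) x) s]
  have hpt : ∀ x, frobeniusNormSq (fderiv ℝ (curl (m - fun y => (-s) • h y)) x) =
      frobeniusNormSq (fderiv ℝ (curl m) x) +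
        2 * s * ∑ i, ⟪fderiv ℝ (curl m) x (EuclideanSpace.basisFun (Fin 3) ℝ i),
          fderiv ℝ (curl h) x (EuclideanSpace.basisFun (Fin 3) ℝ i)⟫_ℝ + s ^ 2 * frobeniusNormSq (fderiv ℝ (curl h) x) :=
    fun x => by rw [hfd x]; exact frobeniusNormSq_add_smul _ _ _
  simp_rw [hpt]
  rw [integral_add (f := fun x => frobeniusNormSq (fderiv ℝ (curl m) x) + 2 * s * ∑ i, ⟪fderiv ℝ (curl m) x
        (EuclideanSpace.basisFun (Fin 3) ℝ i), fderiv ℝ (curl h) x (EuclideanSpace.basisFun (Fin 3) ℝ i)⟫_ℝ)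
      (g := fun x => s ^ 2 * frobeniusNormSq (fderiv ℝ (curl h) x)) (Im.add (Imh.const_mul _)) (Ih.const_mul _),
    integral_add (f := fun x => frobeniusNormSq (fderiv ℝ (curl m) x)) (g := fun x => 2 * s * ∑ i, ⟪fderiv ℝ (curl m) x
        (EuclideanSpace.basisFun (Fin 3) ℝ i), fderiv ℝ (curl h) x (EuclideanSpace.basisFun (Fin 3) ℝ i)⟫_ℝ) Im (Imh.const_mul _),
    integral_const_mul, integral_const_mul]

/-- **Stretching along the segment**: `S(m + sh) = S(m) + sS₁ + s²S₂ + s³S(h)` with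
`S₁ = T(h,m,m) + T(m,h,m) + T(m,m,h)`, `S₂ = T(h,h,m) + T(h,m,h) + T(m,h,h)`, `T(a,b,c) = ∫⟪curl a, Db curl c⟫`
(`stretching_expand` with `r = sh` and homogeneity). [folklore] -/
theorem stretching_variation {m h : EuclideanSpace ℝ (Fin 3) → EuclideanSpace ℝ (Fin 3)}
    (hm : ContDiff ℝ (⊤ : ℕ∞) m ∧ VectorCalculus.IsDivFree m ∧ (∫⁻ x, ‖iteratedFDeriv ℝ 0 m x‖ₑ ^ 2 < ⊤) ∧
      (∫⁻ x, ‖iteratedFDeriv ℝ 1 m x‖ₑ ^ 2 < ⊤) ∧ (∫⁻ x, ‖iteratedFDeriv ℝ 2 m x‖ₑ ^ 2 < ⊤))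
    (hh : ContDiff ℝ (⊤ : ℕ∞) h ∧ VectorCalculus.IsDivFree h ∧ (∫⁻ x, ‖iteratedFDeriv ℝ 0 h x‖ₑ ^ 2 < ⊤) ∧
      (∫⁻ x, ‖iteratedFDeriv ℝ 1 h x‖ₑ ^ 2 < ⊤) ∧ (∫⁻ x, ‖iteratedFDeriv ℝ 2 h x‖ₑ ^ 2 < ⊤)) (s : ℝ) :
    (∫ x, ⟪curl (m - fun y => (-s) • h y) x, fderiv ℝ (m - fun y => (-s) • h y) x (curl (m - fun y => (-s) • h y) x)⟫_ℝ) =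
      (∫ x, ⟪curl m x, fderiv ℝ m x (curl m x)⟫_ℝ) +
      s * ((∫ x, ⟪curl h x, fderiv ℝ m x (curl m x)⟫_ℝ) + (∫ x, ⟪curl m x, fderiv ℝ h x (curl m x)⟫_ℝ) +
        (∫ x, ⟪curl m x, fderiv ℝ m x (curl h x)⟫_ℝ)) +
      s ^ 2 * ((∫ x, ⟪curl h x, fderiv ℝ h x (curl m x)⟫_ℝ) + (∫ x, ⟪curl h x, fderiv ℝ m x (curl h x)⟫_ℝ) +
        (∫ x, ⟪curl m x, fderiv ℝ h x (curl h x)⟫_ℝ)) +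
      s ^ 3 * ∫ x, ⟪curl h x, fderiv ℝ h x (curl h x)⟫_ℝ := by
  have hexp := stretching_expand (admissible_segment hm hh s) hm
  obtain ⟨-, -, hr, hcr, hdr⟩ := segment_pointwise hm.1 hh.1 s
  rw [hr] at hexp
  rw [hexp]
  have hhd : Differentiable ℝ h := hh.1.differentiable (by simp)
  -- homogeneity of each term
  have e3 : (∫ x, ⟪curl (fun y => s • h y) x, fderiv ℝ (fun y => s • h y) x (curl (fun y => s • h y) x)⟫_ℝ) =
      s ^ 3 * ∫ x, ⟪curl h x, fderiv ℝ h x (curl h x)⟫_ℝ := stretching_const_smul hhd s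
  have eA : (∫ x, ⟪curl (fun y => s • h y) x, fderiv ℝ m x (curl m x)⟫_ℝ) = s * ∫ x, ⟪curl h x, fderiv ℝ m x (curl m x)⟫_ℝ := by
    rw [← integral_const_mul]
    exact integral_congr_ae (ae_of_all _ fun x => by simp only [hcr x, real_inner_smul_left])
  have eB : (∫ x, ⟪curl m x, fderiv ℝ (fun y => s • h y) x (curl m x)⟫_ℝ) = s * ∫ x, ⟪curl m x, fderiv ℝ h x (curl m x)⟫_ℝ := by
    rw [← integral_const_mul]
    exact integral_congr_ae (ae_of_all _ fun x => by
      simp only [hdr x, FunLike.coe_smul, Pi.smul_apply, real_inner_smul_right])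
  have eC : (∫ x, ⟪curl m x, fderiv ℝ m x (curl (fun y => s • h y) x)⟫_ℝ) = s * ∫ x, ⟪curl m x, fderiv ℝ m x (curl h x)⟫_ℝ := by
    rw [← integral_const_mul]
    exact integral_congr_ae (ae_of_all _ fun x => by simp only [hcr x, map_smul, real_inner_smul_right])
  have eD : (∫ x, ⟪curl (fun y => s • h y) x, fderiv ℝ (fun y => s • h y) x (curl m x)⟫_ℝ) =
      s ^ 2 * ∫ x, ⟪curl h x, fderiv ℝ h x (curl m x)⟫_ℝ := by
    rw [← integral_const_mul]
    exact integral_congr_ae (ae_of_all _ fun x => by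
      simp only [hcr x, hdr x, FunLike.coe_smul, Pi.smul_apply, real_inner_smul_left, real_inner_smul_right]; ring)
  have eE : (∫ x, ⟪curl (fun y => s • h y) x, fderiv ℝ m x (curl (fun y => s • h y) x)⟫_ℝ) =
      s ^ 2 * ∫ x, ⟪curl h x, fderiv ℝ m x (curl h x)⟫_ℝ := by
    rw [← integral_const_mul]
    exact integral_congr_ae (ae_of_all _ fun x => by
      simp only [hcr x, map_smul, real_inner_smul_left, real_inner_smul_right]; ring)
  have eF : (∫ x, ⟪curl m x, fderiv ℝ (fun y => s • h y) x (curl (fun y => s • h y) x)⟫_ℝ) =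
      s ^ 2 * ∫ x, ⟪curl m x, fderiv ℝ h x (curl h x)⟫_ℝ := by
    rw [← integral_const_mul]
    exact integral_congr_ae (ae_of_all _ fun x => by
      simp only [hcr x, hdr x, FunLike.coe_smul, Pi.smul_apply, map_smul, real_inner_smul_right]; ring)
  rw [e3, eA, eB, eC, eD, eE, eF]
  ring

/-! ## §3 The Euler–Lagrange identity -/

/-- Derivative at `0` of a real cubic `a + sb + s²c + s³d`: it is `b`. [folklore] -/
theorem hasDerivAt_cubic_zero (a b c d : ℝ) : HasDerivAt (fun s : ℝ => a + s * b + s ^ 2 * c + s ^ 3 * d) b 0 := by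
  have h1 : HasDerivAt (fun s : ℝ => a + s * b) (1 * b) 0 := ((hasDerivAt_id (0 : ℝ)).mul_const b).const_add a
  have h2 : HasDerivAt (fun s : ℝ => s ^ 2 * c) (((2 : ℕ) : ℝ) * (0 : ℝ) ^ (2 - 1) * c) 0 := (hasDerivAt_pow 2 (0 : ℝ)).mul_const c
  have h3 : HasDerivAt (fun s : ℝ => s ^ 3 * d) (((3 : ℕ) : ℝ) * (0 : ℝ) ^ (3 - 1) * d) 0 := (hasDerivAt_pow 3 (0 : ℝ)).mul_const d
  have h := (h1.add h2).add h3
  have e : (((fun s : ℝ => a + s * b) + fun s : ℝ => s ^ 2 * c) + fun s : ℝ => s ^ 3 * d) =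
      fun s : ℝ => a + s * b + s ^ 2 * c + s ^ 3 * d := by
    funext s; simp only [Pi.add_apply]
  rw [e] at h
  refine h.congr_deriv ?_
  norm_num

/-- Derivative at `0` of `a + 2sb + s²c`: it is `2b`. [folklore] -/
theorem hasDerivAt_quadratic_zero (a b c : ℝ) : HasDerivAt (fun s : ℝ => a + 2 * s * b + s ^ 2 * c) (2 * b) 0 := by
  have h1 : HasDerivAt (fun s : ℝ => a + 2 * s * b) (2 * 1 * b) 0 :=
    (((hasDerivAt_id (0 : ℝ)).const_mul 2).mul_const b).const_add a
  have h2 : HasDerivAt (fun s : ℝ => s ^ 2 * c) (((2 : ℕ) : ℝ) * (0 : ℝ) ^ (2 - 1) * c) 0 := (hasDerivAt_pow 2 (0 : ℝ)).mul_const c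
  have h := h1.add h2
  have e : ((fun s : ℝ => a + 2 * s * b) + fun s : ℝ => s ^ 2 * c) = fun s : ℝ => a + 2 * s * b + s ^ 2 * c := by
    funext s; simp only [Pi.add_apply]
  rw [e] at h
  refine h.congr_deriv ?_
  norm_num

/-- **Euler–Lagrange identity of the Lu–Doering extremisers.** Let `c` be an admissible Lu–Doering constant
(`S(v) ≤ c Z(v)^{3/4} Pal(v)^{3/4}` on the admissible class) and let the admissible `m` with `Z(m), Pal(m) > 0` saturate it,
`S(m) = c Z(m)^{3/4} Pal(m)^{3/4}`. Then for every admissible direction `h`, with `B = ∫⟪curl m, curl h⟫`,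
`P₁ = ∫Σᵢ⟪D curl m eᵢ, D curl h eᵢ⟫` and the first variation of the stretching
`S₁ = ∫⟪curl h, Dm curl m⟫ + ∫⟪curl m, Dh curl m⟫ + ∫⟪curl m, Dm curl h⟫`:
`S₁ = (3/2) · c Z(m)^{3/4} Pal(m)^{3/4} · (B/Z(m) + P₁/Pal(m))` — the weak Euler–Lagrange equation
`δS(m) = (3/2) S(m) (−Δm/Z(m) + Δ²m/Pal(m))` tested on `h` (`s = 0` maximises the `C¹` function
`s ↦ S(m+sh) − c (Z(m+sh))^{3/4}(Pal(m+sh))^{3/4}`). [cite: LuDoering2008, §3] -/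
theorem eulerLagrange_of_maximiser {c : ℝ} {m h : EuclideanSpace ℝ (Fin 3) → EuclideanSpace ℝ (Fin 3)}
    (hm : ContDiff ℝ (⊤ : ℕ∞) m ∧ VectorCalculus.IsDivFree m ∧ (∫⁻ x, ‖iteratedFDeriv ℝ 0 m x‖ₑ ^ 2 < ⊤) ∧
      (∫⁻ x, ‖iteratedFDeriv ℝ 1 m x‖ₑ ^ 2 < ⊤) ∧ (∫⁻ x, ‖iteratedFDeriv ℝ 2 m x‖ₑ ^ 2 < ⊤))
    (hh : ContDiff ℝ (⊤ : ℕ∞) h ∧ VectorCalculus.IsDivFree h ∧ (∫⁻ x, ‖iteratedFDeriv ℝ 0 h x‖ₑ ^ 2 < ⊤) ∧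
      (∫⁻ x, ‖iteratedFDeriv ℝ 1 h x‖ₑ ^ 2 < ⊤) ∧ (∫⁻ x, ‖iteratedFDeriv ℝ 2 h x‖ₑ ^ 2 < ⊤))
    (hc : ∀ v : EuclideanSpace ℝ (Fin 3) → EuclideanSpace ℝ (Fin 3), (ContDiff ℝ (⊤ : ℕ∞) v ∧
      VectorCalculus.IsDivFree v ∧ (∫⁻ x, ‖iteratedFDeriv ℝ 0 v x‖ₑ ^ 2 < ⊤) ∧
      (∫⁻ x, ‖iteratedFDeriv ℝ 1 v x‖ₑ ^ 2 < ⊤) ∧ (∫⁻ x, ‖iteratedFDeriv ℝ 2 v x‖ₑ ^ 2 < ⊤)) →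
      (∫ x, ⟪curl v x, fderiv ℝ v x (curl v x)⟫_ℝ) ≤
        c * (∫ x, ‖curl v x‖ ^ 2) ^ (3 / 4 : ℝ) * (∫ x, frobeniusNormSq (fderiv ℝ (curl v) x)) ^ (3 / 4 : ℝ))
    (hZ : 0 < ∫ x, ‖curl m x‖ ^ 2) (hP : 0 < ∫ x, frobeniusNormSq (fderiv ℝ (curl m) x))
    (hmax : (∫ x, ⟪curl m x, fderiv ℝ m x (curl m x)⟫_ℝ) =
      c * (∫ x, ‖curl m x‖ ^ 2) ^ (3 / 4 : ℝ) * (∫ x, frobeniusNormSq (fderiv ℝ (curl m) x)) ^ (3 / 4 : ℝ)) :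
    (∫ x, ⟪curl h x, fderiv ℝ m x (curl m x)⟫_ℝ) + (∫ x, ⟪curl m x, fderiv ℝ h x (curl m x)⟫_ℝ) +
        (∫ x, ⟪curl m x, fderiv ℝ m x (curl h x)⟫_ℝ) =
      3 / 2 * (c * (∫ x, ‖curl m x‖ ^ 2) ^ (3 / 4 : ℝ) * (∫ x, frobeniusNormSq (fderiv ℝ (curl m) x)) ^ (3 / 4 : ℝ)) *
        ((∫ x, ⟪curl m x, curl h x⟫_ℝ) / (∫ x, ‖curl m x‖ ^ 2) +
          (∫ x, ∑ i, ⟪fderiv ℝ (curl m) x (EuclideanSpace.basisFun (Fin 3) ℝ i),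
            fderiv ℝ (curl h) x (EuclideanSpace.basisFun (Fin 3) ℝ i)⟫_ℝ) / (∫ x, frobeniusNormSq (fderiv ℝ (curl m) x))) := by
  -- the maximality inequality along the segment, in polynomial form
  have hineq : ∀ s : ℝ, (∫ x, ⟪curl m x, fderiv ℝ m x (curl m x)⟫_ℝ) +
      s * ((∫ x, ⟪curl h x, fderiv ℝ m x (curl m x)⟫_ℝ) + (∫ x, ⟪curl m x, fderiv ℝ h x (curl m x)⟫_ℝ) +
        (∫ x, ⟪curl m x, fderiv ℝ m x (curl h x)⟫_ℝ)) +
      s ^ 2 * ((∫ x, ⟪curl h x, fderiv ℝ h x (curl m x)⟫_ℝ) + (∫ x, ⟪curl h x, fderiv ℝ m x (curl h x)⟫_ℝ) +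
        (∫ x, ⟪curl m x, fderiv ℝ h x (curl h x)⟫_ℝ)) +
      s ^ 3 * (∫ x, ⟪curl h x, fderiv ℝ h x (curl h x)⟫_ℝ) ≤
      c * ((∫ x, ‖curl m x‖ ^ 2) + 2 * s * (∫ x, ⟪curl m x, curl h x⟫_ℝ) + s ^ 2 * ∫ x, ‖curl h x‖ ^ 2) ^ (3 / 4 : ℝ) *
        ((∫ x, frobeniusNormSq (fderiv ℝ (curl m) x)) +
          2 * s * (∫ x, ∑ i, ⟪fderiv ℝ (curl m) x (EuclideanSpace.basisFun (Fin 3) ℝ i),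
            fderiv ℝ (curl h) x (EuclideanSpace.basisFun (Fin 3) ℝ i)⟫_ℝ) +
          s ^ 2 * ∫ x, frobeniusNormSq (fderiv ℝ (curl h) x)) ^ (3 / 4 : ℝ) := by
    intro s
    have h0 := hc _ (admissible_segment hm hh s)
    rwa [stretching_variation hm hh s, enstrophy_variation hm.1 hm.2.2.2.1 hh.1 hh.2.2.2.1 s,
      palinstrophy_variation hm.1 hm.2.2.2.2 hh.1 hh.2.2.2.2 s] at h0
  -- abbreviations
  set S0 : ℝ := ∫ x, ⟪curl m x, fderiv ℝ m x (curl m x)⟫_ℝ with hS0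
  set S1 : ℝ := (∫ x, ⟪curl h x, fderiv ℝ m x (curl m x)⟫_ℝ) + (∫ x, ⟪curl m x, fderiv ℝ h x (curl m x)⟫_ℝ) +
    (∫ x, ⟪curl m x, fderiv ℝ m x (curl h x)⟫_ℝ) with hS1
  set S2 : ℝ := (∫ x, ⟪curl h x, fderiv ℝ h x (curl m x)⟫_ℝ) + (∫ x, ⟪curl h x, fderiv ℝ m x (curl h x)⟫_ℝ) +
    (∫ x, ⟪curl m x, fderiv ℝ h x (curl h x)⟫_ℝ) with hS2
  set S3 : ℝ := ∫ x, ⟪curl h x, fderiv ℝ h x (curl h x)⟫_ℝ with hS3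
  set Z0 : ℝ := ∫ x, ‖curl m x‖ ^ 2 with hZ0
  set B : ℝ := ∫ x, ⟪curl m x, curl h x⟫_ℝ with hB
  set Zh : ℝ := ∫ x, ‖curl h x‖ ^ 2 with hZh
  set P0 : ℝ := ∫ x, frobeniusNormSq (fderiv ℝ (curl m) x) with hP0
  set P1 : ℝ := ∫ x, ∑ i, ⟪fderiv ℝ (curl m) x (EuclideanSpace.basisFun (Fin 3) ℝ i),
    fderiv ℝ (curl h) x (EuclideanSpace.basisFun (Fin 3) ℝ i)⟫_ℝ with hP1
  set Ph : ℝ := ∫ x, frobeniusNormSq (fderiv ℝ (curl h) x) with hPh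
  -- the `C¹` function maximised at `s = 0`
  set F : ℝ → ℝ := fun s => S0 + s * S1 + s ^ 2 * S2 + s ^ 3 * S3 -
    c * (Z0 + 2 * s * B + s ^ 2 * Zh) ^ (3 / 4 : ℝ) * (P0 + 2 * s * P1 + s ^ 2 * Ph) ^ (3 / 4 : ℝ) with hF
  have hF0 : F 0 = 0 := by
    simp only [hF, zero_mul, mul_zero, add_zero, zero_pow two_ne_zero, zero_pow three_ne_zero, hmax, sub_self]
  have hFle : ∀ s, F s ≤ F 0 := fun s => by
    rw [hF0]
    exact sub_nonpos.2 (hineq s)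
  have hloc : IsLocalMax F 0 := Filter.Eventually.of_forall hFle
  -- its derivative at `0`
  have hZne : (fun s : ℝ => Z0 + 2 * s * B + s ^ 2 * Zh) 0 ≠ 0 := by
    simp only [mul_zero, zero_mul, add_zero, zero_pow two_ne_zero]; exact hZ.ne'
  have hPne : (fun s : ℝ => P0 + 2 * s * P1 + s ^ 2 * Ph) 0 ≠ 0 := by
    simp only [mul_zero, zero_mul, add_zero, zero_pow two_ne_zero]; exact hP.ne'
  have hZr := (hasDerivAt_quadratic_zero Z0 B Zh).rpow_const (p := (3 / 4 : ℝ)) (Or.inl hZne)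
  have hPr := (hasDerivAt_quadratic_zero P0 P1 Ph).rpow_const (p := (3 / 4 : ℝ)) (Or.inl hPne)
  have hprod := (hZr.const_mul c).mul hPr
  have hFd : HasDerivAt F (S1 - (c * (2 * B * (3 / 4 : ℝ) * (Z0 + 2 * 0 * B + 0 ^ 2 * Zh) ^ ((3 / 4 : ℝ) - 1)) *
      (P0 + 2 * 0 * P1 + 0 ^ 2 * Ph) ^ (3 / 4 : ℝ) + c * (Z0 + 2 * 0 * B + 0 ^ 2 * Zh) ^ (3 / 4 : ℝ) *
      (2 * P1 * (3 / 4 : ℝ) * (P0 + 2 * 0 * P1 + 0 ^ 2 * Ph) ^ ((3 / 4 : ℝ) - 1)))) 0 :=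
    (hasDerivAt_cubic_zero S0 S1 S2 S3).sub hprod
  have hzero := hloc.hasDerivAt_eq_zero hFd
  rw [Real.rpow_sub_one hZne, Real.rpow_sub_one hPne] at hzero
  simp only [mul_zero, zero_mul, add_zero, zero_pow two_ne_zero] at hzero
  rw [sub_eq_zero] at hzero
  rw [hzero]
  field_simp
  ring

/-- **Euler–Lagrange identity, normal form.** For a saturating admissible `m` with `Z(m) = Pal(m) = 1`:
`S₁(m; h) = (3c/2) · (∫⟪curl m, curl h⟫ + ∫Σᵢ⟪D curl m eᵢ, D curl h eᵢ⟫)` for every admissible `h` — the weak form of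
`δS(m) = (3c⋆/2)(−Δ + Δ²) m` modulo gradients. [cite: LuDoering2008, §3] -/
theorem eulerLagrange_of_normalisedMaximiser {c : ℝ} {m h : EuclideanSpace ℝ (Fin 3) → EuclideanSpace ℝ (Fin 3)}
    (hm : ContDiff ℝ (⊤ : ℕ∞) m ∧ VectorCalculus.IsDivFree m ∧ (∫⁻ x, ‖iteratedFDeriv ℝ 0 m x‖ₑ ^ 2 < ⊤) ∧
      (∫⁻ x, ‖iteratedFDeriv ℝ 1 m x‖ₑ ^ 2 < ⊤) ∧ (∫⁻ x, ‖iteratedFDeriv ℝ 2 m x‖ₑ ^ 2 < ⊤))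
    (hh : ContDiff ℝ (⊤ : ℕ∞) h ∧ VectorCalculus.IsDivFree h ∧ (∫⁻ x, ‖iteratedFDeriv ℝ 0 h x‖ₑ ^ 2 < ⊤) ∧
      (∫⁻ x, ‖iteratedFDeriv ℝ 1 h x‖ₑ ^ 2 < ⊤) ∧ (∫⁻ x, ‖iteratedFDeriv ℝ 2 h x‖ₑ ^ 2 < ⊤))
    (hc : ∀ v : EuclideanSpace ℝ (Fin 3) → EuclideanSpace ℝ (Fin 3), (ContDiff ℝ (⊤ : ℕ∞) v ∧
      VectorCalculus.IsDivFree v ∧ (∫⁻ x, ‖iteratedFDeriv ℝ 0 v x‖ₑ ^ 2 < ⊤) ∧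
      (∫⁻ x, ‖iteratedFDeriv ℝ 1 v x‖ₑ ^ 2 < ⊤) ∧ (∫⁻ x, ‖iteratedFDeriv ℝ 2 v x‖ₑ ^ 2 < ⊤)) →
      (∫ x, ⟪curl v x, fderiv ℝ v x (curl v x)⟫_ℝ) ≤
        c * (∫ x, ‖curl v x‖ ^ 2) ^ (3 / 4 : ℝ) * (∫ x, frobeniusNormSq (fderiv ℝ (curl v) x)) ^ (3 / 4 : ℝ))
    (hZ1 : (∫ x, ‖curl m x‖ ^ 2) = 1) (hP1 : (∫ x, frobeniusNormSq (fderiv ℝ (curl m) x)) = 1)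
    (hmax : (∫ x, ⟪curl m x, fderiv ℝ m x (curl m x)⟫_ℝ) = c) :
    (∫ x, ⟪curl h x, fderiv ℝ m x (curl m x)⟫_ℝ) + (∫ x, ⟪curl m x, fderiv ℝ h x (curl m x)⟫_ℝ) +
        (∫ x, ⟪curl m x, fderiv ℝ m x (curl h x)⟫_ℝ) =
      3 / 2 * c * ((∫ x, ⟪curl m x, curl h x⟫_ℝ) +
        ∫ x, ∑ i, ⟪fderiv ℝ (curl m) x (EuclideanSpace.basisFun (Fin 3) ℝ i),
          fderiv ℝ (curl h) x (EuclideanSpace.basisFun (Fin 3) ℝ i)⟫_ℝ) := by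
  have hmax' : (∫ x, ⟪curl m x, fderiv ℝ m x (curl m x)⟫_ℝ) =
      c * (∫ x, ‖curl m x‖ ^ 2) ^ (3 / 4 : ℝ) * (∫ x, frobeniusNormSq (fderiv ℝ (curl m) x)) ^ (3 / 4 : ℝ) := by
    rw [hZ1, hP1, Real.one_rpow, mul_one, mul_one, hmax]
  have h := eulerLagrange_of_maximiser hm hh hc (by rw [hZ1]; exact one_pos) (by rw [hP1]; exact one_pos) hmax'
  rw [hZ1, hP1, Real.one_rpow, mul_one, mul_one, div_one, div_one] at h
  linear_combination h

end SeqCore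

end NearSaturationNearMaximiser

end Summit.NavierStokesRegularity.NavierStokesRegularity.Theorems

end
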